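import Summits.QuantumFields.YangMills.Theorems.FluctuationComparisonRegPrIntLOrganTangentLawClausesOfILawAE
import HarnessLib

/-!
# Crux `FluctuationComparisonRegPrIntL` (stmt-QuantumFields-20520, rung R3), PATH-B organ, H-currency cone — (L51a) «THE LAW FACTS OF THE PATH DOORS ARE THE FRAME'S»:
# the `hlaw` letter of the KER′ path doors ✓`kerX_organ` (L46′) and ✓`kerV3_organ` (L47) DISCHARGED from REG′ (its landed a.e.-Lipschitz form) + the knit-side `hpath`
# + the frame's measurability — no new letter

Cell `ym3-torus` (YM ladder rung R3 = continuum `SU(2)` Yang–Mills on the three-torus — a RUNG: NOT d = 4, NOT infinite volume, NOT a mass gap, NOT Clay).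
Width seat `ym-ust-20520-w5` (gen 26), `--kind proof --supports stmt-QuantumFields-20520 --as helper`, count-neutral, DEFINITION-FREE, default heartbeats,
no registry ∕ binder ∕ `Lines/` edit.  Over ✓`…OrganTangentLawClausesOfILawAE` (`measurable_wNum_relPath`), LEAD w3 g27's (C1) ✓`…OrganTangentAEDifferentiableFamily`
(`ae_ae_hasDerivAt_deriv_of_lipschitzOn`) and (C2) ✓`…OrganTangentLawResponseLipAE` (`aestronglyMeasurable_deriv_of_ae_hasDerivAt`, `aestronglyMeasurable_section`), Mathlib's
`HasDerivAt.le_of_lipschitzOn`.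

WHY.  The KER′ doors of the two (I-law) PATH blocks (✓p825419 `kerX_organ`, ✓p825783 `kerV3_organ`) carry, besides the cumulant kernels and the profiles, a «law facts» letter
`hlaw`: a.e. in the path parameter `s ∈ [0,1]`, the normalised law `Law_s := wNum_t(X s)∕∫wNum_t(X s)` is integrable with `∫ Law_s = 1`, and the observables (`ΔF`; for V3 also
`ΣF`, `ΔF·ΣF`), the SCORE `Sc_s := deriv_s wNum ∕ wNum`, and their products against the score are `Law_s`-integrable (5 facts for X, 9 for V3).  These are SAME-LAW facts,
and the chain already holds everything they need: REG′ (✓p823910 `ilawRegX∕V3_of_beta_of_incr`: a.e.-`z` Lipschitz moduli `b, bΔ` ∕ `b, bD, bS, bDS` of `s ↦ wNum`, `s ↦ G·wNum`,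
INTEGRABLE), the knit-side `hpath` (✓`l1jSq∕jv3Sq_of_ilawAE`: integrability of `wNum`, `G·wNum` at every `s ∈ [0,1]`, `∫wNum ≠ 0`) and the frame measurability
(`hΦm hJm hρm hρ′m hχc` ⟹ ✓`measurable_wNum_relPath`).  This file turns the letter into a theorem of those.

HOW (all [folklore]).  Pointwise, `G·(d∕w)·(w∕c) = G·d∕c` off `{w = 0}` and `= 0` on it (Lean `x∕0 = 0`), so `|G·Sc·Law| ≤ |G·deriv_s wNum|∕|∫wNum|` EVERYWHERE
(`abs_mul_score_mul_law_le`).  For τ-a.e. `z` and every `s ∈ [0,1]`: if `wNum(·,z)` is differentiable at `s`, `s ↦ G z·wNum(s,z)` has derivative `G z·deriv_s wNum` there and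
Mathlib's `HasDerivAt.le_of_lipschitzOn` bounds it by the modulus `|b_G z|`; if not, `deriv = 0`.  Measurability of `z ↦ deriv_s wNum(s,z)` holds at a.e. `s` ((C1) + (C2)).
The plain integrabilities are `hpath`'s divided by the constant `∫wNum`.
INHABITATION (★★OWNER RULING №100; LEAD w3 g28 №29): OWN-LAW — every fact concerns the SAME moving law `Law_s` and its OWN score (`Sc_s·Law_s = ∂_s wNum_s∕∫wNum_s`); no
cross-law object; discharged HERE (a theorem, not a letter).

WHAT.  §0 (generic fibre `Z`, weight family `w : ℝ → Z → ℝ`): `abs_mul_score_mul_law_le`, ★`integrable_mul_score_mul_law` (ONE multiplier at ONE `s`), ★★`lawFacts_of_lip_ae`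
(the five facts a.e. in `s`), ★★`lawFacts₃_of_lip_ae` (the nine).  §1 ★★★`lawFactsX_of_reg` ∕ ★★★`lawFactsV3_of_reg` (and the per-`t` readings `…_at`) — conclusions = the `hlaw` hypothesis texts of
✓`kerX_organ` ∕ ✓`kerV3_organ` VERBATIM; hypotheses = `hmF`, `hΦm hJm hρm hρ′m hχc`, `hpath` (✓`jv3Sq_of_ilawAE`'s text; for X the same `∀ t` reading of ✓`l1jSq_of_ilawAE`'s), `hreg` (= REG′,
✓`ilawRegX∕V3_of_beta_of_incr`'s conclusion read `∀ t ∈ [0,1]`).  ⇒ the (I-law) path blocks' KER′ letter list loses «law facts»; left: (G₂∕G₃^{prof}), (K1-path), (S-PROF),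
(SC-PROF-X), masses.

HONEST FRAMING: measure theory [folklore] over HYPOTHESIS texts; REG′ and `hpath` themselves remain letters (REG′ ⟸ ✓p823910's chart letters; `hpath` ⟸ the knit's suppliers);
nothing of Bałaban's analysis is asserted or proved; (G₂∕G₃^{prof}) ∕ profiles ∕ D0 letters, (I-curv), (I-cov), `OrganDischargeInputsHJ(sq)` ∕ `SpreadFibreLawH(J)(sq)`
UNDISCHARGED; the five registered stubs of `Lines/semiclassical_s2beta.lean`, crux 20520 and `YM3TorusSU2` are NOT proved; registry untouched; rung R3 = SU(2) YM₃ on T³ —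
NOT d = 4, NOT infinite volume, NOT a mass gap, NOT Clay; the Yang–Mills mass gap is NOT proved.  [folklore]
-/

set_option autoImplicit false

noncomputable section

namespace Summit.QuantumFields.YangMills.Theorems.OrganTangentILawPathLawFactsOfReg

open MeasureTheory Filter Topology Set Function
open scoped ENNReal NNReal
open Literature.MathematicalPhysics.QuantumFieldTheory.Balaban1983to89 T3ContinuumYM3Torus T3NestedUnitLaws T3UnitLawDensityEML T4Continuum BalabanUVClass
  T3UnitScaleTilt T3LevelShift T3TiltDescent
open T4CubeChartExp (expPt)
open Summit.QuantumFields.YangMills.Theorems.FluctuationComparisonRegPrIntLRunpairOrganFibreLaw (mwCut wNum)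
open Summit.QuantumFields.YangMills.Theorems.OrganTangentLawClausesOfILawAE (measurable_wNum_relPath)
open Summit.QuantumFields.YangMills.Theorems.OrganTangentAEDifferentiableFamily (ae_ae_hasDerivAt_deriv_of_lipschitzOn)
open Summit.QuantumFields.YangMills.Theorems.OrganTangentLawResponseLipAE (aestronglyMeasurable_deriv_of_ae_hasDerivAt aestronglyMeasurable_section)

/-! ## §0 Generic fibre: the score against its own law -/

section Abstract

variable {Z : Type*} [MeasurableSpace Z] {τ : Measure Z}

/-- Pointwise: `|G·(d∕w)·(w∕c)| ≤ |G·d|∕|c|` — equality off `{w = 0}`, and the left side vanishes on it (`x∕0 = 0`). [folklore] -/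
theorem abs_mul_score_mul_law_le (G d w c : ℝ) : |G * (d / w) * (w / c)| ≤ |G * d| / |c| := by
  by_cases hw : w = 0
  · rw [hw, zero_div, mul_zero, abs_zero]; positivity
  · have e : G * (d / w) * (w / c) = G * d / c := by
      rw [mul_assoc, div_mul_div_comm, mul_comm d w, mul_div_mul_left _ _ hw, ← mul_div_assoc]
    rw [e, abs_div]

/-- ★ **ONE MULTIPLIER AGAINST THE SCORE, AT ONE PARAMETER**: if `s ↦ G z·w s z` is a.e.-`z` Lipschitz near `s` with an integrable modulus and `z ↦ deriv (w · z) s` is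
a.e.-strongly measurable, then `z ↦ G z·(deriv (w · z) s ∕ w s z)·(w s z ∕ c)` is integrable (dominated by `|b_G z|∕|c|`). [folklore] -/
theorem integrable_mul_score_mul_law {w : ℝ → Z → ℝ} {G bG : Z → ℝ} {U : Set ℝ} {s : ℝ} (hUs : U ∈ 𝓝 s)
    (hG : AEStronglyMeasurable G τ) (hws : AEStronglyMeasurable (w s) τ)
    (hd : AEStronglyMeasurable (fun z => deriv (fun s => w s z) s) τ)
    (hlipG : ∀ᵐ z ∂τ, LipschitzOnWith (Real.nnabs (bG z)) (fun s => G z * w s z) U) (hbG : Integrable bG τ) (c : ℝ) :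
    Integrable (fun z => G z * (deriv (fun s => w s z) s / w s z) * (w s z / c)) τ := by
  refine Integrable.mono' (hbG.abs.div_const |c|) ?_ ?_
  · exact ((hG.aemeasurable.mul (hd.aemeasurable.div hws.aemeasurable)).mul (hws.aemeasurable.div_const c)).aestronglyMeasurable
  · filter_upwards [hlipG] with z hz
    rw [Real.norm_eq_abs]
    refine (abs_mul_score_mul_law_le _ _ _ _).trans (div_le_div_of_nonneg_right ?_ (abs_nonneg c))
    by_cases hdiff : DifferentiableAt ℝ (fun s => w s z) s
    · have h := (hdiff.hasDerivAt.const_mul (G z)).le_of_lipschitzOn hUs hz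
      rwa [Real.norm_eq_abs, Real.coe_nnabs] at h
    · rw [deriv_zero_of_not_differentiableAt hdiff, mul_zero, abs_zero]; exact abs_nonneg _

/-- ★★ **THE FIVE LAW FACTS, A.E. IN THE PATH PARAMETER** (one observable `G`): along a jointly measurable weight family `w` with a.e.-`z` Lipschitz moduli for `w` and `G·w`
(integrable), integrability of `w s`, `G·w s` and `∫ w s ≠ 0` on `[0,1]`: for a.e. `s ∈ [0,1]` the normalised law `w s∕∫w s` is integrable with total mass `1`, and `G`, the score
`deriv (w · z) s∕w s z`, and `G·score` are integrable against it. [folklore] -/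
theorem lawFacts_of_lip_ae [SFinite τ] {w : ℝ → Z → ℝ} {G : Z → ℝ} {U : Set ℝ} (hU : IsOpen U) (hUI : Icc (0:ℝ) 1 ⊆ U)
    (hG : AEStronglyMeasurable G τ) (hwm : Measurable (fun p : ℝ × Z => w p.1 p.2))
    (hint : ∀ s ∈ Icc (0:ℝ) 1, Integrable (w s) τ) (hintG : ∀ s ∈ Icc (0:ℝ) 1, Integrable (fun z => G z * w s z) τ)
    (hZ : ∀ s ∈ Icc (0:ℝ) 1, ∫ z, w s z ∂τ ≠ 0)
    {b : Z → ℝ} (hlip : ∀ᵐ z ∂τ, LipschitzOnWith (Real.nnabs (b z)) (fun s => w s z) U) (hbi : Integrable b τ)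
    {bG : Z → ℝ} (hlipG : ∀ᵐ z ∂τ, LipschitzOnWith (Real.nnabs (bG z)) (fun s => G z * w s z) U) (hbGi : Integrable bG τ) :
    ∀ᵐ s ∂(volume : Measure ℝ), s ∈ Icc (0:ℝ) 1 →
      Integrable (fun z => w s z / ∫ z', w s z' ∂τ) τ ∧ ∫ z, w s z / ∫ z', w s z' ∂τ ∂τ = 1 ∧
      Integrable (fun z => G z * (w s z / ∫ z', w s z' ∂τ)) τ ∧
      Integrable (fun z => (deriv (fun s => w s z) s / w s z) * (w s z / ∫ z', w s z' ∂τ)) τ ∧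
      Integrable (fun z => G z * (deriv (fun s => w s z) s / w s z) * (w s z / ∫ z', w s z' ∂τ)) τ := by
  have hmeas : ∀ s, AEStronglyMeasurable (w s) τ := aestronglyMeasurable_section hwm
  have h1 : ∀ᵐ z ∂τ, LipschitzOnWith (Real.nnabs (b z)) (fun s => (1:ℝ) * w s z) U := by
    filter_upwards [hlip] with z hz; simpa only [one_mul] using hz
  filter_upwards [ae_ae_hasDerivAt_deriv_of_lipschitzOn hU hUI τ hwm hlip] with s hs hsI
  have hd := aestronglyMeasurable_deriv_of_ae_hasDerivAt hmeas (hs hsI)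
  have hUs : U ∈ 𝓝 s := hU.mem_nhds (hUI hsI)
  refine ⟨(hint s hsI).div_const _, ?_, ?_, ?_, ?_⟩
  · rw [integral_div, div_self (hZ s hsI)]
  · simpa only [mul_div_assoc] using (hintG s hsI).div_const (∫ z', w s z' ∂τ)
  · simpa only [one_mul] using integrable_mul_score_mul_law hUs aestronglyMeasurable_const (hmeas s) hd h1 hbi (∫ z', w s z' ∂τ)
  · exact integrable_mul_score_mul_law hUs hG (hmeas s) hd hlipG hbGi _

/-- ★★ **THE NINE LAW FACTS** (two observables `D`, `S` and their product): as ✓`lawFacts_of_lip_ae` with moduli for `w`, `D·w`, `S·w`, `(D·S)·w`. [folklore] -/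
theorem lawFacts₃_of_lip_ae [SFinite τ] {w : ℝ → Z → ℝ} {D S : Z → ℝ} {U : Set ℝ} (hU : IsOpen U) (hUI : Icc (0:ℝ) 1 ⊆ U)
    (hD : AEStronglyMeasurable D τ) (hS : AEStronglyMeasurable S τ) (hwm : Measurable (fun p : ℝ × Z => w p.1 p.2))
    (hint : ∀ s ∈ Icc (0:ℝ) 1, Integrable (w s) τ) (hintD : ∀ s ∈ Icc (0:ℝ) 1, Integrable (fun z => D z * w s z) τ)
    (hintS : ∀ s ∈ Icc (0:ℝ) 1, Integrable (fun z => S z * w s z) τ) (hintDS : ∀ s ∈ Icc (0:ℝ) 1, Integrable (fun z => (D z * S z) * w s z) τ)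
    (hZ : ∀ s ∈ Icc (0:ℝ) 1, ∫ z, w s z ∂τ ≠ 0)
    {b : Z → ℝ} (hlip : ∀ᵐ z ∂τ, LipschitzOnWith (Real.nnabs (b z)) (fun s => w s z) U) (hbi : Integrable b τ)
    {bD : Z → ℝ} (hlipD : ∀ᵐ z ∂τ, LipschitzOnWith (Real.nnabs (bD z)) (fun s => D z * w s z) U) (hbDi : Integrable bD τ)
    {bS : Z → ℝ} (hlipS : ∀ᵐ z ∂τ, LipschitzOnWith (Real.nnabs (bS z)) (fun s => S z * w s z) U) (hbSi : Integrable bS τ)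
    {bDS : Z → ℝ} (hlipDS : ∀ᵐ z ∂τ, LipschitzOnWith (Real.nnabs (bDS z)) (fun s => (D z * S z) * w s z) U) (hbDSi : Integrable bDS τ) :
    ∀ᵐ s ∂(volume : Measure ℝ), s ∈ Icc (0:ℝ) 1 →
      Integrable (fun z => (w s z / ∫ z', w s z' ∂τ)) τ ∧ ∫ z, (w s z / ∫ z', w s z' ∂τ) ∂τ = 1 ∧
      Integrable (fun z => D z * (w s z / ∫ z', w s z' ∂τ)) τ ∧
      Integrable (fun z => S z * (w s z / ∫ z', w s z' ∂τ)) τ ∧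
      Integrable (fun z => (deriv (fun s => w s z) s / w s z) * (w s z / ∫ z', w s z' ∂τ)) τ ∧
      Integrable (fun z => D z * S z * (w s z / ∫ z', w s z' ∂τ)) τ ∧
      Integrable (fun z => D z * (deriv (fun s => w s z) s / w s z) * (w s z / ∫ z', w s z' ∂τ)) τ ∧
      Integrable (fun z => S z * (deriv (fun s => w s z) s / w s z) * (w s z / ∫ z', w s z' ∂τ)) τ ∧
      Integrable (fun z => D z * S z * (deriv (fun s => w s z) s / w s z) * (w s z / ∫ z', w s z' ∂τ)) τ := by
  have hmeas : ∀ s, AEStronglyMeasurable (w s) τ := aestronglyMeasurable_section hwm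
  filter_upwards [lawFacts_of_lip_ae hU hUI hD hwm hint hintD hZ hlip hbi hlipD hbDi,
    ae_ae_hasDerivAt_deriv_of_lipschitzOn hU hUI τ hwm hlip] with s hs hs' hsI
  obtain ⟨hL, hL1, hDL, hScL, hDScL⟩ := hs hsI
  have hd := aestronglyMeasurable_deriv_of_ae_hasDerivAt hmeas (hs' hsI)
  have hUs : U ∈ 𝓝 s := hU.mem_nhds (hUI hsI)
  refine ⟨hL, hL1, hDL, ?_, hScL, ?_, hDScL, ?_, ?_⟩
  · simpa only [mul_div_assoc] using (hintS s hsI).div_const (∫ z', w s z' ∂τ)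
  · simpa only [mul_div_assoc] using (hintDS s hsI).div_const (∫ z', w s z' ∂τ)
  · exact integrable_mul_score_mul_law hUs hS (hmeas s) hd hlipS hbSi _
  · exact integrable_mul_score_mul_law hUs (hD.mul hS) (hmeas s) hd hlipDS hbDSi _

end Abstract

/-! ## §1 The organ: ✓`kerX_organ`'s and ✓`kerV3_organ`'s `hlaw` texts from REG′ + `hpath` + the frame -/

section Organ

/-- ★★★ **THE LAW FACTS OF THE (I-law-X)sq PATH DOOR ARE THE FRAME'S, AT ONE `t`** — conclusion = the `hlaw` hypothesis text of ✓`kerX_organ` read at `t` (its body after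
`∀ t ∈ [0,1]`) VERBATIM; `hpath` = ✓`l1jSq_of_ilawAE`'s knit-side text VERBATIM; `hreg` = the conclusion text of ✓`ilawRegX_of_beta_of_incr` (at `t`) VERBATIM. [folklore] -/
theorem lawFactsX_of_reg_at (F : T3Family) (γ b₀ p₀ : ℝ) (j Ts : ℕ)
    (ρ ρ' : (i : ℕ) → GaugeField (F.P i) 0 ↥(Matrix.specialUnitaryGroup (Fin 2) ℂ) → ℝ) {Z : Type} [MeasurableSpace Z] (τ : Measure Z) [SFinite τ]
    (Φ : GaugeField (F.P j) 0 ↥(Matrix.specialUnitaryGroup (Fin 2) ℂ) × Z → GaugeField (F.P Ts) 0 ↥(Matrix.specialUnitaryGroup (Fin 2) ℂ))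
    (J : GaugeField (F.P j) 0 ↥(Matrix.specialUnitaryGroup (Fin 2) ℂ) × Z → NNReal) (rc : ℝ)
    (hmF : ∀ (V : GaugeField (F.P j) 0 ↥(Matrix.specialUnitaryGroup (Fin 2) ℂ)), AEStronglyMeasurable (fun z => Real.log (ρ Ts (Φ (V, z))) - Real.log (ρ' Ts (Φ (V, z)))) τ)
    (hΦm : Measurable Φ) (hJm : Measurable J) (hρm : Measurable (ρ Ts)) (hρ'm : Measurable (ρ' Ts)) (hχc : Continuous (mwCut F γ b₀ p₀ j Ts)) (t : ℝ)
    (hpath : ∀ (B B' : PBond (F.P j) 0) (m m' : Fin 3 → ℝ) (U₁ V₁ : GaugeField (F.P j) 0 ↥(Matrix.specialUnitaryGroup (Fin 2) ℂ)) (X : ℝ → GaugeField (F.P j) 0 ↥(Matrix.specialUnitaryGroup (Fin 2) ℂ)), ‖m‖ ≤ rc * (θBal F.L γ b₀ p₀ j / 4) → ‖m'‖ ≤ rc * (θBal F.L γ b₀ p₀ j / 4) →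
      PlaqSmall (θBal F.L γ b₀ p₀ j / 4) U₁ → PlaqSmall (θBal F.L γ b₀ p₀ j / 4) V₁ → (∀ e, e ≠ B → V₁ e = U₁ e) → V₁ B = U₁ B * expPt m → (∀ s e, e ≠ B' → X s e = V₁ e) → (∀ s, X s B' = V₁ B' * expPt (s • m')) →
      ∀ s ∈ Set.Icc (0:ℝ) 1, Integrable (fun z => wNum F γ b₀ p₀ j Ts ρ ρ' Φ J t (X s) z) τ ∧ Integrable (fun z => (Real.log (ρ Ts (Φ (U₁, z))) - Real.log (ρ' Ts (Φ (U₁, z)))) * wNum F γ b₀ p₀ j Ts ρ ρ' Φ J t (X s) z) τ ∧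
        Integrable (fun z => (Real.log (ρ Ts (Φ (V₁, z))) - Real.log (ρ' Ts (Φ (V₁, z)))) * wNum F γ b₀ p₀ j Ts ρ ρ' Φ J t (X s) z) τ ∧ ∫ z, wNum F γ b₀ p₀ j Ts ρ ρ' Φ J t (X s) z ∂τ ≠ 0)
    (hreg : ∀ (B B' : PBond (F.P j) 0) (m m' : Fin 3 → ℝ) (U₁ V₁ W₂ : GaugeField (F.P j) 0 ↥(Matrix.specialUnitaryGroup (Fin 2) ℂ)), ‖m‖ ≤ rc * (θBal F.L γ b₀ p₀ j / 4) → ‖m'‖ ≤ rc * (θBal F.L γ b₀ p₀ j / 4) → PlaqSmall (θBal F.L γ b₀ p₀ j / 4) U₁ → PlaqSmall (θBal F.L γ b₀ p₀ j / 4) V₁ → PlaqSmall (θBal F.L γ b₀ p₀ j / 4) W₂ → (∀ e, e ≠ B → V₁ e = U₁ e) → V₁ B = U₁ B * expPt m → (∀ e, e ≠ B' → W₂ e = V₁ e) → W₂ B' = V₁ B' * expPt m' → ∀ (X : ℝ → GaugeField (F.P j) 0 ↥(Matrix.specialUnitaryGroup (Fin 2) ℂ)), (∀ s e, e ≠ B'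 → X s e = V₁ e) → (∀ s, X s B' = V₁ B' * expPt (s • m')) →
      (∃ (b bΔ : Z → ℝ), Integrable b τ ∧ Integrable bΔ τ ∧
        (∀ᵐ z ∂τ, LipschitzOnWith (Real.nnabs (b z)) (fun s => wNum F γ b₀ p₀ j Ts ρ ρ' Φ J t (X s) z) (Set.Ioo (-1) 2)) ∧
        (∀ᵐ z ∂τ, LipschitzOnWith (Real.nnabs (bΔ z)) (fun s => ((Real.log (ρ Ts (Φ (V₁, z))) - Real.log (ρ' Ts (Φ (V₁, z)))) - (Real.log (ρ Ts (Φ (U₁, z))) - Real.log (ρ' Ts (Φ (U₁, z))))) * wNum F γ b₀ p₀ j Ts ρ ρ' Φ J t (X s) z) (Set.Ioo (-1) 2)))) :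
    ∀ (B B' : PBond (F.P j) 0) (m m' : Fin 3 → ℝ) (U₁ V₁ W₂ : GaugeField (F.P j) 0 ↥(Matrix.specialUnitaryGroup (Fin 2) ℂ)),
      ‖m‖ ≤ rc * (θBal F.L γ b₀ p₀ j / 4) → ‖m'‖ ≤ rc * (θBal F.L γ b₀ p₀ j / 4) → PlaqSmall (θBal F.L γ b₀ p₀ j / 4) U₁ → PlaqSmall (θBal F.L γ b₀ p₀ j / 4) V₁ →
      PlaqSmall (θBal F.L γ b₀ p₀ j / 4) W₂ →
      (∀ e, e ≠ B → V₁ e = U₁ e) → V₁ B = U₁ B * expPt m → (∀ e, e ≠ B' → W₂ e = V₁ e) → W₂ B' = V₁ B' * expPt m' →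
      ∀ (X : ℝ → GaugeField (F.P j) 0 ↥(Matrix.specialUnitaryGroup (Fin 2) ℂ)), (∀ s e, e ≠ B' → X s e = V₁ e) → (∀ s, X s B' = V₁ B' * expPt (s • m')) →
      ∀ᵐ s ∂(volume : Measure ℝ), s ∈ Set.Icc (0:ℝ) 1 →
        Integrable (fun z => wNum F γ b₀ p₀ j Ts ρ ρ' Φ J t (X s) z / ∫ z', wNum F γ b₀ p₀ j Ts ρ ρ' Φ J t (X s) z' ∂τ) τ ∧ ∫ z, wNum F γ b₀ p₀ j Ts ρ ρ' Φ J t (X s) z / ∫ z', wNum F γ b₀ p₀ j Ts ρ ρ' Φ J t (X s) z' ∂τ ∂τ = 1 ∧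
        Integrable (fun z => ((Real.log (ρ Ts (Φ (V₁, z))) - Real.log (ρ' Ts (Φ (V₁, z)))) - (Real.log (ρ Ts (Φ (U₁, z))) - Real.log (ρ' Ts (Φ (U₁, z))))) * (wNum F γ b₀ p₀ j Ts ρ ρ' Φ J t (X s) z / ∫ z', wNum F γ b₀ p₀ j Ts ρ ρ' Φ J t (X s) z' ∂τ)) τ ∧
        Integrable (fun z => (deriv (fun s => wNum F γ b₀ p₀ j Ts ρ ρ' Φ J t (X s) z) s / wNum F γ b₀ p₀ j Ts ρ ρ' Φ J t (X s) z) * (wNum F γ b₀ p₀ j Ts ρ ρ' Φ J t (X s) z / ∫ z', wNum F γ b₀ p₀ j Ts ρ ρ' Φ J t (X s) z' ∂τ)) τ ∧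
        Integrable (fun z => ((Real.log (ρ Ts (Φ (V₁, z))) - Real.log (ρ' Ts (Φ (V₁, z)))) - (Real.log (ρ Ts (Φ (U₁, z))) - Real.log (ρ' Ts (Φ (U₁, z))))) * (deriv (fun s => wNum F γ b₀ p₀ j Ts ρ ρ' Φ J t (X s) z) s / wNum F γ b₀ p₀ j Ts ρ ρ' Φ J t (X s) z) * (wNum F γ b₀ p₀ j Ts ρ ρ' Φ J t (X s) z / ∫ z', wNum F γ b₀ p₀ j Ts ρ ρ' Φ J t (X s) z' ∂τ)) τ := by
  intro B B' m m' U₁ V₁ W₂ hm hm' hU hV hW hVU hVB hWU hWB X hoff hon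
  obtain ⟨b, bΔ, hbi, hbΔi, hlip, hlipΔ⟩ := hreg B B' m m' U₁ V₁ W₂ hm hm' hU hV hW hVU hVB hWU hWB X hoff hon
  have hp := hpath B B' m m' U₁ V₁ X hm hm' hU hV hVU hVB hoff hon
  have hwm := measurable_wNum_relPath F γ b₀ p₀ j Ts ρ ρ' Φ J hΦm hJm hρm hρ'm hχc t B' m' V₁ X hoff hon
  have hiG : ∀ s ∈ Icc (0:ℝ) 1, Integrable (fun z => ((Real.log (ρ Ts (Φ (V₁, z))) - Real.log (ρ' Ts (Φ (V₁, z)))) - (Real.log (ρ Ts (Φ (U₁, z))) - Real.log (ρ' Ts (Φ (U₁, z))))) * wNum F γ b₀ p₀ j Ts ρ ρ' Φ J t (X s) z) τ := by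
    intro s hs
    have e : (fun z => ((Real.log (ρ Ts (Φ (V₁, z))) - Real.log (ρ' Ts (Φ (V₁, z)))) - (Real.log (ρ Ts (Φ (U₁, z))) - Real.log (ρ' Ts (Φ (U₁, z))))) * wNum F γ b₀ p₀ j Ts ρ ρ' Φ J t (X s) z)
        = fun z => (Real.log (ρ Ts (Φ (V₁, z))) - Real.log (ρ' Ts (Φ (V₁, z)))) * wNum F γ b₀ p₀ j Ts ρ ρ' Φ J t (X s) z - (Real.log (ρ Ts (Φ (U₁, z))) - Real.log (ρ' Ts (Φ (U₁, z)))) * wNum F γ b₀ p₀ j Ts ρ ρ' Φ J t (X s) z := by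
      funext z; ring
    rw [e]
    exact (hp s hs).2.2.1.sub (hp s hs).2.1
  exact lawFacts_of_lip_ae (w := fun s z => wNum F γ b₀ p₀ j Ts ρ ρ' Φ J t (X s) z)
    (G := fun z => (Real.log (ρ Ts (Φ (V₁, z))) - Real.log (ρ' Ts (Φ (V₁, z)))) - (Real.log (ρ Ts (Φ (U₁, z))) - Real.log (ρ' Ts (Φ (U₁, z)))))
    isOpen_Ioo (Icc_subset_Ioo (by norm_num) (by norm_num)) ((hmF V₁).sub (hmF U₁)) hwm
    (fun s hs => (hp s hs).1) hiG (fun s hs => (hp s hs).2.2.2) hlip hbi hlipΔ hbΔi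

/-- ★★★ **THE LAW FACTS OF THE (I-law-X)sq PATH DOOR ARE THE FRAME'S** — conclusion = the `hlaw` hypothesis text of ✓`kerX_organ` VERBATIM (`∀ t ∈ [0,1]`); `hpath` = the
`∀ t` reading of ✓`l1jSq_of_ilawAE`'s knit-side text; `hreg` = REG′ = the conclusion of ✓`ilawRegX_of_beta_of_incr` read `∀ t ∈ [0,1]`. [folklore] -/
theorem lawFactsX_of_reg (F : T3Family) (γ b₀ p₀ : ℝ) (j Ts : ℕ)
    (ρ ρ' : (i : ℕ) → GaugeField (F.P i) 0 ↥(Matrix.specialUnitaryGroup (Fin 2) ℂ) → ℝ) {Z : Type} [MeasurableSpace Z] (τ : Measure Z) [SFinite τ]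
    (Φ : GaugeField (F.P j) 0 ↥(Matrix.specialUnitaryGroup (Fin 2) ℂ) × Z → GaugeField (F.P Ts) 0 ↥(Matrix.specialUnitaryGroup (Fin 2) ℂ))
    (J : GaugeField (F.P j) 0 ↥(Matrix.specialUnitaryGroup (Fin 2) ℂ) × Z → NNReal) (rc : ℝ)
    (hmF : ∀ (V : GaugeField (F.P j) 0 ↥(Matrix.specialUnitaryGroup (Fin 2) ℂ)), AEStronglyMeasurable (fun z => Real.log (ρ Ts (Φ (V, z))) - Real.log (ρ' Ts (Φ (V, z)))) τ)
    (hΦm : Measurable Φ) (hJm : Measurable J) (hρm : Measurable (ρ Ts)) (hρ'm : Measurable (ρ' Ts)) (hχc : Continuous (mwCut F γ b₀ p₀ j Ts))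
    (hpath : ∀ (t : ℝ), 0 ≤ t → t ≤ 1 → ∀ (B B' : PBond (F.P j) 0) (m m' : Fin 3 → ℝ) (U₁ V₁ : GaugeField (F.P j) 0 ↥(Matrix.specialUnitaryGroup (Fin 2) ℂ)) (X : ℝ → GaugeField (F.P j) 0 ↥(Matrix.specialUnitaryGroup (Fin 2) ℂ)), ‖m‖ ≤ rc * (θBal F.L γ b₀ p₀ j / 4) → ‖m'‖ ≤ rc * (θBal F.L γ b₀ p₀ j / 4) →
      PlaqSmall (θBal F.L γ b₀ p₀ j / 4) U₁ → PlaqSmall (θBal F.L γ b₀ p₀ j / 4) V₁ → (∀ e, e ≠ B → V₁ e = U₁ e) → V₁ B = U₁ B * expPt m → (∀ s e, e ≠ B' → X s e = V₁ e) → (∀ s, X s B' = V₁ B' * expPt (s • m')) →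
      ∀ s ∈ Set.Icc (0:ℝ) 1, Integrable (fun z => wNum F γ b₀ p₀ j Ts ρ ρ' Φ J t (X s) z) τ ∧ Integrable (fun z => (Real.log (ρ Ts (Φ (U₁, z))) - Real.log (ρ' Ts (Φ (U₁, z)))) * wNum F γ b₀ p₀ j Ts ρ ρ' Φ J t (X s) z) τ ∧
        Integrable (fun z => (Real.log (ρ Ts (Φ (V₁, z))) - Real.log (ρ' Ts (Φ (V₁, z)))) * wNum F γ b₀ p₀ j Ts ρ ρ' Φ J t (X s) z) τ ∧ ∫ z, wNum F γ b₀ p₀ j Ts ρ ρ' Φ J t (X s) z ∂τ ≠ 0)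
    (hreg : ∀ t : ℝ, 0 ≤ t → t ≤ 1 → ∀ (B B' : PBond (F.P j) 0) (m m' : Fin 3 → ℝ) (U₁ V₁ W₂ : GaugeField (F.P j) 0 ↥(Matrix.specialUnitaryGroup (Fin 2) ℂ)), ‖m‖ ≤ rc * (θBal F.L γ b₀ p₀ j / 4) → ‖m'‖ ≤ rc * (θBal F.L γ b₀ p₀ j / 4) → PlaqSmall (θBal F.L γ b₀ p₀ j / 4) U₁ → PlaqSmall (θBal F.L γ b₀ p₀ j / 4) V₁ → PlaqSmall (θBal F.L γ b₀ p₀ j / 4) W₂ → (∀ e, e ≠ B → V₁ e = U₁ e) → V₁ B = U₁ B * expPt m → (∀ e, e ≠ B' → W₂ e = V₁ e) → W₂ B' = V₁ B' * expPt m' → ∀ (X : ℝ → GaugeField (F.P j) 0 ↥(Matrix.specialUnitaryGroup (Fin 2) ℂ)), (∀ s e, e ≠ B' → X s e = V₁ e) → (∀ s, X s B' = V₁ B' * expPt (s • m')) →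
      (∃ (b bΔ : Z → ℝ), Integrable b τ ∧ Integrable bΔ τ ∧
        (∀ᵐ z ∂τ, LipschitzOnWith (Real.nnabs (b z)) (fun s => wNum F γ b₀ p₀ j Ts ρ ρ' Φ J t (X s) z) (Set.Ioo (-1) 2)) ∧
        (∀ᵐ z ∂τ, LipschitzOnWith (Real.nnabs (bΔ z)) (fun s => ((Real.log (ρ Ts (Φ (V₁, z))) - Real.log (ρ' Ts (Φ (V₁, z)))) - (Real.log (ρ Ts (Φ (U₁, z))) - Real.log (ρ' Ts (Φ (U₁, z))))) * wNum F γ b₀ p₀ j Ts ρ ρ' Φ J t (X s) z) (Set.Ioo (-1) 2)))) :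
    ∀ t : ℝ, 0 ≤ t → t ≤ 1 → ∀ (B B' : PBond (F.P j) 0) (m m' : Fin 3 → ℝ) (U₁ V₁ W₂ : GaugeField (F.P j) 0 ↥(Matrix.specialUnitaryGroup (Fin 2) ℂ)),
      ‖m‖ ≤ rc * (θBal F.L γ b₀ p₀ j / 4) → ‖m'‖ ≤ rc * (θBal F.L γ b₀ p₀ j / 4) → PlaqSmall (θBal F.L γ b₀ p₀ j / 4) U₁ → PlaqSmall (θBal F.L γ b₀ p₀ j / 4) V₁ →
      PlaqSmall (θBal F.L γ b₀ p₀ j / 4) W₂ →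
      (∀ e, e ≠ B → V₁ e = U₁ e) → V₁ B = U₁ B * expPt m → (∀ e, e ≠ B' → W₂ e = V₁ e) → W₂ B' = V₁ B' * expPt m' →
      ∀ (X : ℝ → GaugeField (F.P j) 0 ↥(Matrix.specialUnitaryGroup (Fin 2) ℂ)), (∀ s e, e ≠ B' → X s e = V₁ e) → (∀ s, X s B' = V₁ B' * expPt (s • m')) →
      ∀ᵐ s ∂(volume : Measure ℝ), s ∈ Set.Icc (0:ℝ) 1 →
        Integrable (fun z => wNum F γ b₀ p₀ j Ts ρ ρ' Φ J t (X s) z / ∫ z', wNum F γ b₀ p₀ j Ts ρ ρ' Φ J t (X s) z' ∂τ) τ ∧ ∫ z, wNum F γ b₀ p₀ j Ts ρ ρ' Φ J t (X s) z / ∫ z', wNum F γ b₀ p₀ j Ts ρ ρ' Φ J t (X s) z' ∂τ ∂τ = 1 ∧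
        Integrable (fun z => ((Real.log (ρ Ts (Φ (V₁, z))) - Real.log (ρ' Ts (Φ (V₁, z)))) - (Real.log (ρ Ts (Φ (U₁, z))) - Real.log (ρ' Ts (Φ (U₁, z))))) * (wNum F γ b₀ p₀ j Ts ρ ρ' Φ J t (X s) z / ∫ z', wNum F γ b₀ p₀ j Ts ρ ρ' Φ J t (X s) z' ∂τ)) τ ∧
        Integrable (fun z => (deriv (fun s => wNum F γ b₀ p₀ j Ts ρ ρ' Φ J t (X s) z) s / wNum F γ b₀ p₀ j Ts ρ ρ' Φ J t (X s) z) * (wNum F γ b₀ p₀ j Ts ρ ρ' Φ J t (X s) z / ∫ z', wNum F γ b₀ p₀ j Ts ρ ρ' Φ J t (X s) z' ∂τ)) τ ∧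
        Integrable (fun z => ((Real.log (ρ Ts (Φ (V₁, z))) - Real.log (ρ' Ts (Φ (V₁, z)))) - (Real.log (ρ Ts (Φ (U₁, z))) - Real.log (ρ' Ts (Φ (U₁, z))))) * (deriv (fun s => wNum F γ b₀ p₀ j Ts ρ ρ' Φ J t (X s) z) s / wNum F γ b₀ p₀ j Ts ρ ρ' Φ J t (X s) z) * (wNum F γ b₀ p₀ j Ts ρ ρ' Φ J t (X s) z / ∫ z', wNum F γ b₀ p₀ j Ts ρ ρ' Φ J t (X s) z' ∂τ)) τ :=
  fun t ht0 ht1 => lawFactsX_of_reg_at F γ b₀ p₀ j Ts ρ ρ' τ Φ J rc hmF hΦm hJm hρm hρ'm hχc t (hpath t ht0 ht1) (hreg t ht0 ht1)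

/-- ★★★ **THE LAW FACTS OF THE (I-law-V3)sq PATH DOOR ARE THE FRAME'S, AT ONE `t`** — conclusion = the body of ✓`kerV3_organ`'s `hlaw` text at `t` VERBATIM; `hpath` = the body
of ✓`jv3Sq_of_ilawAE`'s knit-side text at `t`; `hreg` = the conclusion text of ✓`ilawRegV3_of_beta_of_incr` (at `t`) VERBATIM. [folklore] -/
theorem lawFactsV3_of_reg_at (F : T3Family) (γ b₀ p₀ : ℝ) (j Ts : ℕ)
    (ρ ρ' : (i : ℕ) → GaugeField (F.P i) 0 ↥(Matrix.specialUnitaryGroup (Fin 2) ℂ) → ℝ) {Z : Type} [MeasurableSpace Z] (τ : Measure Z) [SFinite τ]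
    (Φ : GaugeField (F.P j) 0 ↥(Matrix.specialUnitaryGroup (Fin 2) ℂ) × Z → GaugeField (F.P Ts) 0 ↥(Matrix.specialUnitaryGroup (Fin 2) ℂ))
    (J : GaugeField (F.P j) 0 ↥(Matrix.specialUnitaryGroup (Fin 2) ℂ) × Z → NNReal) (rc : ℝ)
    (hmF : ∀ (V : GaugeField (F.P j) 0 ↥(Matrix.specialUnitaryGroup (Fin 2) ℂ)), AEStronglyMeasurable (fun z => Real.log (ρ Ts (Φ (V, z))) - Real.log (ρ' Ts (Φ (V, z)))) τ)
    (hΦm : Measurable Φ) (hJm : Measurable J) (hρm : Measurable (ρ Ts)) (hρ'm : Measurable (ρ' Ts)) (hχc : Continuous (mwCut F γ b₀ p₀ j Ts)) (t : ℝ)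
    (hpath : ∀ (B B' : PBond (F.P j) 0) (m m' : Fin 3 → ℝ) (U₁ V₁ : GaugeField (F.P j) 0 ↥(Matrix.specialUnitaryGroup (Fin 2) ℂ)) (X : ℝ → GaugeField (F.P j) 0 ↥(Matrix.specialUnitaryGroup (Fin 2) ℂ)), ‖m‖ ≤ rc * (θBal F.L γ b₀ p₀ j / 4) → ‖m'‖ ≤ rc * (θBal F.L γ b₀ p₀ j / 4) →
      PlaqSmall (θBal F.L γ b₀ p₀ j / 4) U₁ → PlaqSmall (θBal F.L γ b₀ p₀ j / 4) V₁ → (∀ e, e ≠ B → V₁ e = U₁ e) → V₁ B = U₁ B * expPt m → (∀ s e, e ≠ B' → X s e = V₁ e) → (∀ s, X s B' = V₁ B' * expPt (s • m')) →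
      ∀ s ∈ Set.Icc (0:ℝ) 1, Integrable (fun z => wNum F γ b₀ p₀ j Ts ρ ρ' Φ J t (X s) z) τ ∧ Integrable (fun z => ((Real.log (ρ Ts (Φ (V₁, z))) - Real.log (ρ' Ts (Φ (V₁, z)))) - (Real.log (ρ Ts (Φ (U₁, z))) - Real.log (ρ' Ts (Φ (U₁, z))))) * wNum F γ b₀ p₀ j Ts ρ ρ' Φ J t (X s) z) τ ∧
        Integrable (fun z => ((Real.log (ρ Ts (Φ (V₁, z))) - Real.log (ρ' Ts (Φ (V₁, z)))) + (Real.log (ρ Ts (Φ (U₁, z))) - Real.log (ρ' Ts (Φ (U₁, z))))) * wNum F γ b₀ p₀ j Ts ρ ρ' Φ J t (X s) z) τ ∧ Integrable (fun z => (((Real.log (ρ Ts (Φ (V₁, z))) - Real.log (ρ' Ts (Φ (V₁, z)))) - (Real.log (ρ Ts (Φ (U₁, z))) - Real.log (ρ' Ts (Φ (U₁, z))))) * ((Real.log (ρ Ts (Φ (V₁, z))) - Real.log (ρ' Ts (Φ (V₁, z)))) + (Real.log (ρ Ts (Φ (U₁, z))) - Real.log (ρ' Ts (Φ (U₁, z))))))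 * wNum F γ b₀ p₀ j Ts ρ ρ' Φ J t (X s) z) τ ∧ ∫ z, wNum F γ b₀ p₀ j Ts ρ ρ' Φ J t (X s) z ∂τ ≠ 0)
    (hreg : ∀ (B B' : PBond (F.P j) 0) (m m' : Fin 3 → ℝ) (U₁ V₁ W₂ : GaugeField (F.P j) 0 ↥(Matrix.specialUnitaryGroup (Fin 2) ℂ)), ‖m‖ ≤ rc * (θBal F.L γ b₀ p₀ j / 4) → ‖m'‖ ≤ rc * (θBal F.L γ b₀ p₀ j / 4) → PlaqSmall (θBal F.L γ b₀ p₀ j / 4) U₁ → PlaqSmall (θBal F.L γ b₀ p₀ j / 4) V₁ → PlaqSmall (θBal F.L γ b₀ p₀ j / 4) W₂ → (∀ e, e ≠ B → V₁ e = U₁ e) → V₁ B = U₁ B * expPt m → (∀ e, e ≠ B' → W₂ e = V₁ e) → W₂ B' = V₁ B' * expPt m' → ∀ (X : ℝ → GaugeField (F.P j) 0 ↥(Matrix.specialUnitaryGroup (Fin 2) ℂ)), (∀ s e, e ≠ B' → X s e = V₁ e) → (∀ s, X s B' = V₁ B' * expPt (s • m')) →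
      (∃ (b bD bS bDS : Z → ℝ), Integrable b τ ∧ Integrable bD τ ∧ Integrable bS τ ∧ Integrable bDS τ ∧
        (∀ᵐ z ∂τ, LipschitzOnWith (Real.nnabs (b z)) (fun s => wNum F γ b₀ p₀ j Ts ρ ρ' Φ J t (X s) z) (Set.Ioo (-1) 2)) ∧
        (∀ᵐ z ∂τ, LipschitzOnWith (Real.nnabs (bD z)) (fun s => ((Real.log (ρ Ts (Φ (V₁, z))) - Real.log (ρ' Ts (Φ (V₁, z)))) - (Real.log (ρ Ts (Φ (U₁, z))) - Real.log (ρ' Ts (Φ (U₁, z))))) * wNum F γ b₀ p₀ j Ts ρ ρ' Φ J t (X s) z) (Set.Ioo (-1) 2)) ∧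
        (∀ᵐ z ∂τ, LipschitzOnWith (Real.nnabs (bS z)) (fun s => ((Real.log (ρ Ts (Φ (V₁, z))) - Real.log (ρ' Ts (Φ (V₁, z)))) + (Real.log (ρ Ts (Φ (U₁, z))) - Real.log (ρ' Ts (Φ (U₁, z))))) * wNum F γ b₀ p₀ j Ts ρ ρ' Φ J t (X s) z) (Set.Ioo (-1) 2)) ∧
        (∀ᵐ z ∂τ, LipschitzOnWith (Real.nnabs (bDS z)) (fun s => (((Real.log (ρ Ts (Φ (V₁, z))) - Real.log (ρ' Ts (Φ (V₁, z)))) - (Real.log (ρ Ts (Φ (U₁, z))) - Real.log (ρ' Ts (Φ (U₁, z))))) * ((Real.log (ρ Ts (Φ (V₁, z))) - Real.log (ρ' Ts (Φ (V₁, z)))) + (Real.log (ρ Ts (Φ (U₁, z))) - Real.log (ρ' Ts (Φ (U₁, z)))))) * wNum F γ b₀ p₀ j Ts ρ ρ' Φ J t (X s) z) (Set.Ioo (-1) 2)))) :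
    ∀ (B B' : PBond (F.P j) 0) (m m' : Fin 3 → ℝ) (U₁ V₁ W₂ : GaugeField (F.P j) 0 ↥(Matrix.specialUnitaryGroup (Fin 2) ℂ)),
      ‖m‖ ≤ rc * (θBal F.L γ b₀ p₀ j / 4) → ‖m'‖ ≤ rc * (θBal F.L γ b₀ p₀ j / 4) → PlaqSmall (θBal F.L γ b₀ p₀ j / 4) U₁ → PlaqSmall (θBal F.L γ b₀ p₀ j / 4) V₁ → PlaqSmall (θBal F.L γ b₀ p₀ j / 4) W₂ →
      (∀ e, e ≠ B → V₁ e = U₁ e) → V₁ B = U₁ B * expPt m → (∀ e, e ≠ B' → W₂ e = V₁ e) → W₂ B' = V₁ B' * expPt m' →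
      ∀ (X : ℝ → GaugeField (F.P j) 0 ↥(Matrix.specialUnitaryGroup (Fin 2) ℂ)), (∀ s e, e ≠ B' → X s e = V₁ e) → (∀ s, X s B' = V₁ B' * expPt (s • m')) →
      ∀ᵐ s ∂(volume : Measure ℝ), s ∈ Set.Icc (0:ℝ) 1 →
        Integrable (fun z => (wNum F γ b₀ p₀ j Ts ρ ρ' Φ J t (X s) z / ∫ z', wNum F γ b₀ p₀ j Ts ρ ρ' Φ J t (X s) z' ∂τ)) τ ∧ ∫ z, (wNum F γ b₀ p₀ j Ts ρ ρ' Φ J t (X s) z / ∫ z', wNum F γ b₀ p₀ j Ts ρ ρ' Φ J t (X s) z' ∂τ) ∂τ = 1 ∧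
        Integrable (fun z => ((Real.log (ρ Ts (Φ (V₁, z))) - Real.log (ρ' Ts (Φ (V₁, z)))) - (Real.log (ρ Ts (Φ (U₁, z))) - Real.log (ρ' Ts (Φ (U₁, z))))) * (wNum F γ b₀ p₀ j Ts ρ ρ' Φ J t (X s) z / ∫ z', wNum F γ b₀ p₀ j Ts ρ ρ' Φ J t (X s) z' ∂τ)) τ ∧
        Integrable (fun z => ((Real.log (ρ Ts (Φ (V₁, z))) - Real.log (ρ' Ts (Φ (V₁, z)))) + (Real.log (ρ Ts (Φ (U₁, z))) - Real.log (ρ' Ts (Φ (U₁, z))))) * (wNum F γ b₀ p₀ j Ts ρ ρ' Φ J t (X s) z / ∫ z', wNum F γ b₀ p₀ j Ts ρ ρ' Φ J t (X s) z' ∂τ)) τ ∧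
        Integrable (fun z => (deriv (fun s => wNum F γ b₀ p₀ j Ts ρ ρ' Φ J t (X s) z) s / wNum F γ b₀ p₀ j Ts ρ ρ' Φ J t (X s) z) * (wNum F γ b₀ p₀ j Ts ρ ρ' Φ J t (X s) z / ∫ z', wNum F γ b₀ p₀ j Ts ρ ρ' Φ J t (X s) z' ∂τ)) τ ∧
        Integrable (fun z => ((Real.log (ρ Ts (Φ (V₁, z))) - Real.log (ρ' Ts (Φ (V₁, z)))) - (Real.log (ρ Ts (Φ (U₁, z))) - Real.log (ρ' Ts (Φ (U₁, z))))) * ((Real.log (ρ Ts (Φ (V₁, z))) - Real.log (ρ' Ts (Φ (V₁, z)))) + (Real.log (ρ Ts (Φ (U₁, z))) - Real.log (ρ' Ts (Φ (U₁, z))))) * (wNum F γ b₀ p₀ j Ts ρ ρ' Φ J t (X s) z / ∫ z', wNum F γ b₀ p₀ j Ts ρ ρ' Φ J t (X s) z' ∂τ)) τ ∧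
        Integrable (fun z => ((Real.log (ρ Ts (Φ (V₁, z))) - Real.log (ρ' Ts (Φ (V₁, z)))) - (Real.log (ρ Ts (Φ (U₁, z))) - Real.log (ρ' Ts (Φ (U₁, z))))) * (deriv (fun s => wNum F γ b₀ p₀ j Ts ρ ρ' Φ J t (X s) z) s / wNum F γ b₀ p₀ j Ts ρ ρ' Φ J t (X s) z) * (wNum F γ b₀ p₀ j Ts ρ ρ' Φ J t (X s) z / ∫ z', wNum F γ b₀ p₀ j Ts ρ ρ' Φ J t (X s) z' ∂τ)) τ ∧
        Integrable (fun z => ((Real.log (ρ Ts (Φ (V₁, z))) - Real.log (ρ' Ts (Φ (V₁, z)))) + (Real.log (ρ Ts (Φ (U₁, z))) - Real.log (ρ' Ts (Φ (U₁, z))))) * (deriv (fun s => wNum F γ b₀ p₀ j Ts ρ ρ' Φ J t (X s) z) s / wNum F γ b₀ p₀ j Ts ρ ρ' Φ J t (X s) z) * (wNum F γ b₀ p₀ j Ts ρ ρ' Φ J t (X s) z / ∫ z', wNum F γ b₀ p₀ j Ts ρ ρ' Φ J t (X s) z' ∂τ)) τ ∧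
        Integrable (fun z => ((Real.log (ρ Ts (Φ (V₁, z))) - Real.log (ρ' Ts (Φ (V₁, z)))) - (Real.log (ρ Ts (Φ (U₁, z))) - Real.log (ρ' Ts (Φ (U₁, z))))) * ((Real.log (ρ Ts (Φ (V₁, z))) - Real.log (ρ' Ts (Φ (V₁, z)))) + (Real.log (ρ Ts (Φ (U₁, z))) - Real.log (ρ' Ts (Φ (U₁, z))))) * (deriv (fun s => wNum F γ b₀ p₀ j Ts ρ ρ' Φ J t (X s) z) s / wNum F γ b₀ p₀ j Ts ρ ρ' Φ J t (X s) z) * (wNum F γ b₀ p₀ j Ts ρ ρ' Φ J t (X s) z / ∫ z', wNum F γ b₀ p₀ j Ts ρ ρ' Φ J t (X s) z' ∂τ)) τ := by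
  intro B B' m m' U₁ V₁ W₂ hm hm' hU hV hW hVU hVB hWU hWB X hoff hon
  obtain ⟨b, bD, bS, bDS, hbi, hbDi, hbSi, hbDSi, hlip, hlipD, hlipS, hlipDS⟩ :=
    hreg B B' m m' U₁ V₁ W₂ hm hm' hU hV hW hVU hVB hWU hWB X hoff hon
  have hp := hpath B B' m m' U₁ V₁ X hm hm' hU hV hVU hVB hoff hon
  have hwm := measurable_wNum_relPath F γ b₀ p₀ j Ts ρ ρ' Φ J hΦm hJm hρm hρ'm hχc t B' m' V₁ X hoff hon
  exact lawFacts₃_of_lip_ae (w := fun s z => wNum F γ b₀ p₀ j Ts ρ ρ' Φ J t (X s) z)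
    (D := fun z => (Real.log (ρ Ts (Φ (V₁, z))) - Real.log (ρ' Ts (Φ (V₁, z)))) - (Real.log (ρ Ts (Φ (U₁, z))) - Real.log (ρ' Ts (Φ (U₁, z)))))
    (S := fun z => (Real.log (ρ Ts (Φ (V₁, z))) - Real.log (ρ' Ts (Φ (V₁, z)))) + (Real.log (ρ Ts (Φ (U₁, z))) - Real.log (ρ' Ts (Φ (U₁, z)))))
    isOpen_Ioo (Icc_subset_Ioo (by norm_num) (by norm_num)) ((hmF V₁).sub (hmF U₁)) ((hmF V₁).add (hmF U₁)) hwm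
    (fun s hs => (hp s hs).1) (fun s hs => (hp s hs).2.1) (fun s hs => (hp s hs).2.2.1) (fun s hs => (hp s hs).2.2.2.1)
    (fun s hs => (hp s hs).2.2.2.2) hlip hbi hlipD hbDi hlipS hbSi hlipDS hbDSi

/-- ★★★ **THE LAW FACTS OF THE (I-law-V3)sq PATH DOOR ARE THE FRAME'S** — conclusion = the `hlaw` hypothesis text of ✓`kerV3_organ` VERBATIM (`∀ t ∈ [0,1]`); `hpath` =
✓`jv3Sq_of_ilawAE`'s knit-side text VERBATIM; `hreg` = REG′ = the conclusion of ✓`ilawRegV3_of_beta_of_incr` read `∀ t ∈ [0,1]`. [folklore] -/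
theorem lawFactsV3_of_reg (F : T3Family) (γ b₀ p₀ : ℝ) (j Ts : ℕ)
    (ρ ρ' : (i : ℕ) → GaugeField (F.P i) 0 ↥(Matrix.specialUnitaryGroup (Fin 2) ℂ) → ℝ) {Z : Type} [MeasurableSpace Z] (τ : Measure Z) [SFinite τ]
    (Φ : GaugeField (F.P j) 0 ↥(Matrix.specialUnitaryGroup (Fin 2) ℂ) × Z → GaugeField (F.P Ts) 0 ↥(Matrix.specialUnitaryGroup (Fin 2) ℂ))
    (J : GaugeField (F.P j) 0 ↥(Matrix.specialUnitaryGroup (Fin 2) ℂ) × Z → NNReal) (rc : ℝ)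
    (hmF : ∀ (V : GaugeField (F.P j) 0 ↥(Matrix.specialUnitaryGroup (Fin 2) ℂ)), AEStronglyMeasurable (fun z => Real.log (ρ Ts (Φ (V, z))) - Real.log (ρ' Ts (Φ (V, z)))) τ)
    (hΦm : Measurable Φ) (hJm : Measurable J) (hρm : Measurable (ρ Ts)) (hρ'm : Measurable (ρ' Ts)) (hχc : Continuous (mwCut F γ b₀ p₀ j Ts))
    (hpath : ∀ (t : ℝ), 0 ≤ t → t ≤ 1 → ∀ (B B' : PBond (F.P j) 0) (m m' : Fin 3 → ℝ) (U₁ V₁ : GaugeField (F.P j) 0 ↥(Matrix.specialUnitaryGroup (Fin 2) ℂ)) (X : ℝ → GaugeField (F.P j) 0 ↥(Matrix.specialUnitaryGroup (Fin 2) ℂ)), ‖m‖ ≤ rc * (θBal F.L γ b₀ p₀ j / 4) → ‖m'‖ ≤ rc * (θBal F.L γ b₀ p₀ j / 4) →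
      PlaqSmall (θBal F.L γ b₀ p₀ j / 4) U₁ → PlaqSmall (θBal F.L γ b₀ p₀ j / 4) V₁ → (∀ e, e ≠ B → V₁ e = U₁ e) → V₁ B = U₁ B * expPt m → (∀ s e, e ≠ B' → X s e = V₁ e) → (∀ s, X s B' = V₁ B' * expPt (s • m')) →
      ∀ s ∈ Set.Icc (0:ℝ) 1, Integrable (fun z => wNum F γ b₀ p₀ j Ts ρ ρ' Φ J t (X s) z) τ ∧ Integrable (fun z => ((Real.log (ρ Ts (Φ (V₁, z))) - Real.log (ρ' Ts (Φ (V₁, z)))) - (Real.log (ρ Ts (Φ (U₁, z))) - Real.log (ρ' Ts (Φ (U₁, z))))) * wNum F γ b₀ p₀ j Ts ρ ρ' Φ J t (X s) z) τ ∧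
        Integrable (fun z => ((Real.log (ρ Ts (Φ (V₁, z))) - Real.log (ρ' Ts (Φ (V₁, z)))) + (Real.log (ρ Ts (Φ (U₁, z))) - Real.log (ρ' Ts (Φ (U₁, z))))) * wNum F γ b₀ p₀ j Ts ρ ρ' Φ J t (X s) z) τ ∧ Integrable (fun z => (((Real.log (ρ Ts (Φ (V₁, z))) - Real.log (ρ' Ts (Φ (V₁, z)))) - (Real.log (ρ Ts (Φ (U₁, z))) - Real.log (ρ' Ts (Φ (U₁, z))))) * ((Real.log (ρ Ts (Φ (V₁, z))) - Real.log (ρ' Ts (Φ (V₁, z)))) + (Real.log (ρ Ts (Φ (U₁, z))) - Real.log (ρ' Ts (Φ (U₁, z)))))) * wNum F γ b₀ p₀ j Ts ρ ρ' Φ J t (X s) z) τ ∧ ∫ z, wNum F γ b₀ p₀ j Ts ρ ρ' Φ J t (X s) z ∂τ ≠ 0)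
    (hreg : ∀ t : ℝ, 0 ≤ t → t ≤ 1 → ∀ (B B' : PBond (F.P j) 0) (m m' : Fin 3 → ℝ) (U₁ V₁ W₂ : GaugeField (F.P j) 0 ↥(Matrix.specialUnitaryGroup (Fin 2) ℂ)), ‖m‖ ≤ rc * (θBal F.L γ b₀ p₀ j / 4) → ‖m'‖ ≤ rc * (θBal F.L γ b₀ p₀ j / 4) → PlaqSmall (θBal F.L γ b₀ p₀ j / 4) U₁ → PlaqSmall (θBal F.L γ b₀ p₀ j / 4) V₁ → PlaqSmall (θBal F.L γ b₀ p₀ j / 4) W₂ → (∀ e, e ≠ B → V₁ e = U₁ e) → V₁ B = U₁ B * expPt m → (∀ e, e ≠ B' → W₂ e = V₁ e) → W₂ B' = V₁ B' * expPt m' → ∀ (X : ℝ → GaugeField (F.P j) 0 ↥(Matrix.specialUnitaryGroup (Fin 2) ℂ)), (∀ s e, e ≠ B' → X s e = V₁ e) → (∀ s, X s B' = V₁ B' * expPt (s • m')) →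
      (∃ (b bD bS bDS : Z → ℝ), Integrable b τ ∧ Integrable bD τ ∧ Integrable bS τ ∧ Integrable bDS τ ∧
        (∀ᵐ z ∂τ, LipschitzOnWith (Real.nnabs (b z)) (fun s => wNum F γ b₀ p₀ j Ts ρ ρ' Φ J t (X s) z) (Set.Ioo (-1) 2)) ∧
        (∀ᵐ z ∂τ, LipschitzOnWith (Real.nnabs (bD z)) (fun s => ((Real.log (ρ Ts (Φ (V₁, z))) - Real.log (ρ' Ts (Φ (V₁, z)))) - (Real.log (ρ Ts (Φ (U₁, z))) - Real.log (ρ' Ts (Φ (U₁, z))))) * wNum F γ b₀ p₀ j Ts ρ ρ' Φ J t (X s) z) (Set.Ioo (-1) 2)) ∧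
        (∀ᵐ z ∂τ, LipschitzOnWith (Real.nnabs (bS z)) (fun s => ((Real.log (ρ Ts (Φ (V₁, z))) - Real.log (ρ' Ts (Φ (V₁, z)))) + (Real.log (ρ Ts (Φ (U₁, z))) - Real.log (ρ' Ts (Φ (U₁, z))))) * wNum F γ b₀ p₀ j Ts ρ ρ' Φ J t (X s) z) (Set.Ioo (-1) 2)) ∧
        (∀ᵐ z ∂τ, LipschitzOnWith (Real.nnabs (bDS z)) (fun s => (((Real.log (ρ Ts (Φ (V₁, z))) - Real.log (ρ' Ts (Φ (V₁, z)))) - (Real.log (ρ Ts (Φ (U₁, z))) - Real.log (ρ' Ts (Φ (U₁, z))))) * ((Real.log (ρ Ts (Φ (V₁, z))) - Real.log (ρ' Ts (Φ (V₁, z)))) + (Real.log (ρ Ts (Φ (U₁, z))) - Real.log (ρ' Ts (Φ (U₁, z)))))) * wNum F γ b₀ p₀ j Ts ρ ρ' Φ J t (X s) z) (Set.Ioo (-1) 2)))) :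
    ∀ t : ℝ, 0 ≤ t → t ≤ 1 → ∀ (B B' : PBond (F.P j) 0) (m m' : Fin 3 → ℝ) (U₁ V₁ W₂ : GaugeField (F.P j) 0 ↥(Matrix.specialUnitaryGroup (Fin 2) ℂ)),
      ‖m‖ ≤ rc * (θBal F.L γ b₀ p₀ j / 4) → ‖m'‖ ≤ rc * (θBal F.L γ b₀ p₀ j / 4) → PlaqSmall (θBal F.L γ b₀ p₀ j / 4) U₁ → PlaqSmall (θBal F.L γ b₀ p₀ j / 4) V₁ → PlaqSmall (θBal F.L γ b₀ p₀ j / 4) W₂ →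
      (∀ e, e ≠ B → V₁ e = U₁ e) → V₁ B = U₁ B * expPt m → (∀ e, e ≠ B' → W₂ e = V₁ e) → W₂ B' = V₁ B' * expPt m' →
      ∀ (X : ℝ → GaugeField (F.P j) 0 ↥(Matrix.specialUnitaryGroup (Fin 2) ℂ)), (∀ s e, e ≠ B' → X s e = V₁ e) → (∀ s, X s B' = V₁ B' * expPt (s • m')) →
      ∀ᵐ s ∂(volume : Measure ℝ), s ∈ Set.Icc (0:ℝ) 1 →
        Integrable (fun z => (wNum F γ b₀ p₀ j Ts ρ ρ' Φ J t (X s) z / ∫ z', wNum F γ b₀ p₀ j Ts ρ ρ' Φ J t (X s) z' ∂τ)) τ ∧ ∫ z, (wNum F γ b₀ p₀ j Ts ρ ρ' Φ J t (X s) z / ∫ z', wNum F γ b₀ p₀ j Ts ρ ρ' Φ J t (X s) z' ∂τ) ∂τ = 1 ∧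
        Integrable (fun z => ((Real.log (ρ Ts (Φ (V₁, z))) - Real.log (ρ' Ts (Φ (V₁, z)))) - (Real.log (ρ Ts (Φ (U₁, z))) - Real.log (ρ' Ts (Φ (U₁, z))))) * (wNum F γ b₀ p₀ j Ts ρ ρ' Φ J t (X s) z / ∫ z', wNum F γ b₀ p₀ j Ts ρ ρ' Φ J t (X s) z' ∂τ)) τ ∧
        Integrable (fun z => ((Real.log (ρ Ts (Φ (V₁, z))) - Real.log (ρ' Ts (Φ (V₁, z)))) + (Real.log (ρ Ts (Φ (U₁, z))) - Real.log (ρ' Ts (Φ (U₁, z))))) * (wNum F γ b₀ p₀ j Ts ρ ρ' Φ J t (X s) z / ∫ z', wNum F γ b₀ p₀ j Ts ρ ρ' Φ J t (X s) z' ∂τ)) τ ∧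
        Integrable (fun z => (deriv (fun s => wNum F γ b₀ p₀ j Ts ρ ρ' Φ J t (X s) z) s / wNum F γ b₀ p₀ j Ts ρ ρ' Φ J t (X s) z) * (wNum F γ b₀ p₀ j Ts ρ ρ' Φ J t (X s) z / ∫ z', wNum F γ b₀ p₀ j Ts ρ ρ' Φ J t (X s) z' ∂τ)) τ ∧
        Integrable (fun z => ((Real.log (ρ Ts (Φ (V₁, z))) - Real.log (ρ' Ts (Φ (V₁, z)))) - (Real.log (ρ Ts (Φ (U₁, z))) - Real.log (ρ' Ts (Φ (U₁, z))))) * ((Real.log (ρ Ts (Φ (V₁, z))) - Real.log (ρ' Ts (Φ (V₁, z)))) + (Real.log (ρ Ts (Φ (U₁, z))) - Real.log (ρ' Ts (Φ (U₁, z))))) * (wNum F γ b₀ p₀ j Ts ρ ρ' Φ J t (X s) z / ∫ z', wNum F γ b₀ p₀ j Ts ρ ρ' Φ J t (X s) z' ∂τ)) τ ∧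
        Integrable (fun z => ((Real.log (ρ Ts (Φ (V₁, z))) - Real.log (ρ' Ts (Φ (V₁, z)))) - (Real.log (ρ Ts (Φ (U₁, z))) - Real.log (ρ' Ts (Φ (U₁, z))))) * (deriv (fun s => wNum F γ b₀ p₀ j Ts ρ ρ' Φ J t (X s) z) s / wNum F γ b₀ p₀ j Ts ρ ρ' Φ J t (X s) z) * (wNum F γ b₀ p₀ j Ts ρ ρ' Φ J t (X s) z / ∫ z', wNum F γ b₀ p₀ j Ts ρ ρ' Φ J t (X s) z' ∂τ)) τ ∧
        Integrable (fun z => ((Real.log (ρ Ts (Φ (V₁, z))) - Real.log (ρ' Ts (Φ (V₁, z)))) + (Real.log (ρ Ts (Φ (U₁, z))) - Real.log (ρ' Ts (Φ (U₁, z))))) * (deriv (fun s => wNum F γ b₀ p₀ j Ts ρ ρ' Φ J t (X s) z) s / wNum F γ b₀ p₀ j Ts ρ ρ' Φ J t (X s) z) * (wNum F γ b₀ p₀ j Ts ρ ρ' Φ J t (X s) z / ∫ z', wNum F γ b₀ p₀ j Ts ρ ρ' Φ J t (X s) z' ∂τ)) τ ∧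
        Integrable (fun z => ((Real.log (ρ Ts (Φ (V₁, z))) - Real.log (ρ' Ts (Φ (V₁, z)))) - (Real.log (ρ Ts (Φ (U₁, z))) - Real.log (ρ' Ts (Φ (U₁, z))))) * ((Real.log (ρ Ts (Φ (V₁, z))) - Real.log (ρ' Ts (Φ (V₁, z)))) + (Real.log (ρ Ts (Φ (U₁, z))) - Real.log (ρ' Ts (Φ (U₁, z))))) * (deriv (fun s => wNum F γ b₀ p₀ j Ts ρ ρ' Φ J t (X s) z) s / wNum F γ b₀ p₀ j Ts ρ ρ' Φ J t (X s) z) * (wNum F γ b₀ p₀ j Ts ρ ρ' Φ J t (X s) z / ∫ z', wNum F γ b₀ p₀ j Ts ρ ρ' Φ J t (X s) z' ∂τ)) τ :=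
  fun t ht0 ht1 => lawFactsV3_of_reg_at F γ b₀ p₀ j Ts ρ ρ' τ Φ J rc hmF hΦm hJm hρm hρ'm hχc t (hpath t ht0 ht1) (hreg t ht0 ht1)

end Organ

end Summit.QuantumFields.YangMills.Theorems.OrganTangentILawPathLawFactsOfReg

end
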